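import Summits.Ventures.HSemireg.WedgeHankelRecurrenceSymbol

/-!
# Venture HSemireg — AGREEMENT OF TWO RATIONAL CLASSES (Padé ∕ LFSR uniqueness in fraction form): for monic `m`, `m′` and residues `a`, `a′` (`deg a < deg m`, `deg a′ < deg m′`), **the dual
# classes `dualSeq m a` and `dualSeq m′ a′` (the moment sequences of `a/m` and `a′/m′`) agree on `[0, N]` with `deg m + deg m′ ≤ N + 1` iff `a·m′ = a′·m`** — and then they agree at EVERY
# index; for reduced symbols (`gcd(m, a) = gcd(m′, a′) = 1`) this forces `m = m′` and `a = a′`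

HONEST FRAMING. Part of the Lean index of the computation cell `pub-hsemireg` (seat p10 gen 30, Sunday typer «UNIFORM-IN-n»).
LINEAR ALGEBRA OF HANKEL (catalecticant) MATRICES and of polynomials over a field ONLY (`Polynomial.modByMonic`): no variety, no cohomology theory, no sheaf, no Ext group and no
semiregularity map is constructed here; nothing here says that HC / HC_CM / HC_AV holds; no Literature fact is declared or used.  Custodian versions as in `WedgeHankelSiegelIdeal` (1/3); the
dictionary («two proper rational functions with denominators of degrees `d`, `d′` whose expansions at `∞` agree in the first `N + 1 ≥ d + d′` coefficients are equal» — uniqueness in the Padé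
table; «two LFSRs of lengths `L`, `L′` producing the same `L + L′` initial terms produce the same sequence») is QUOTED in docstrings, never asserted.

WHAT IS IN THE TREE.  N45 (`WedgeHankelRecurrenceSymbol`, № 327): `dualSeq_mul_left_of_monic` (`dualSeq (g m₁) (g a₁) = dualSeq m₁ a₁`), `dualSeq_eq_dualSeq_mul_left`; N32 (№ 263): `dualSeq`,
`dualSeq_unique` (same modulus `m`, `deg m ≤ N + 1`: equal on `[0, N]` ⇒ equal residues), `dualSeq_add`, `dualSeq_smul`; N18 (№ 173) `mem_degreeLT_succ_iff`.  Mathlib: `Polynomial.Monic.mul`,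
`Polynomial.natDegree_mul`, `Polynomial.eq_of_monic_of_associated`, `associated_of_dvd_dvd`, `IsCoprime.dvd_of_dvd_mul_left` ∕ `_right`, `mul_left_cancel₀`.
THIS FILE (namespace `Summit.Ventures.HSemireg.Wedge.HankelOuter` continued; PLAIN on N45; 0 definitions):
* §631 `dualSeq_eq_dualSeq_prod_left` ∕ `_right` (`dualSeq m a = dualSeq (m m′) (a m′)`, `dualSeq m′ a′ = dualSeq (m m′) (a′ m)`), `mul_mem_degreeLT_add` (degrees);
  **`dualSeq_agree_iff_mul_eq`** (THE THEOREM: equal on `[0, N]`, `deg m + deg m′ ≤ N + 1` ⟺ `a·m′ = a′·m`), **`dualSeq_eq_of_agree`** (then equal at EVERY index),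
  **`eq_and_eq_of_agree_of_isCoprime`** (reduced symbols: `m = m′` and `a = a′`).
Nothing Ext-side.  New names only.
-/

open Module Polynomial
open scoped Matrix Polynomial

namespace Summit.Ventures.HSemireg.Wedge.HankelOuter

open Summit.Ventures.HSemireg.Wedge Summit.Ventures.HSemireg.Wedge.Hankel

variable (K : Type*) [Field K] {N : ℕ}

/-! ## §631. Two rational classes agreeing on a long enough window are equal -/

/-- `dualSeq m a = dualSeq (m·m′) (a·m′)` (common denominator, `m′` monic). -/
theorem dualSeq_eq_dualSeq_prod_left {m m' : K[X]} (hm : m.Monic) (hm' : m'.Monic) (a : K[X]) : dualSeq K m a = dualSeq K (m * m') (a * m') := by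
  rw [mul_comm m m', mul_comm a m']
  exact dualSeq_eq_dualSeq_mul_left K hm hm' a

/-- `dualSeq m′ a′ = dualSeq (m·m′) (a′·m)` (common denominator, `m` monic). -/
theorem dualSeq_eq_dualSeq_prod_right {m m' : K[X]} (hm : m.Monic) (hm' : m'.Monic) (a' : K[X]) : dualSeq K m' a' = dualSeq K (m * m') (a' * m) := by
  rw [mul_comm a' m]
  exact dualSeq_eq_dualSeq_mul_left K hm' hm a'

/-- `deg a < d`, `b` monic of degree `d′ ⇒ a·b ∈ K[X]_{< d + d′}`. -/
theorem mul_mem_degreeLT_add {a b : K[X]} {d : ℕ} (ha : a ∈ Polynomial.degreeLT K d) (hb : b.Monic) : a * b ∈ Polynomial.degreeLT K (d + b.natDegree) := by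
  rw [Polynomial.mem_degreeLT] at ha ⊢
  rcases eq_or_ne a 0 with rfl | ha0
  · rw [zero_mul, Polynomial.degree_zero]; exact WithBot.bot_lt_coe _
  · rw [Polynomial.degree_mul, Polynomial.degree_eq_natDegree hb.ne_zero, Polynomial.degree_eq_natDegree ha0] at *
    exact_mod_cast (by have := (WithBot.coe_lt_coe.mp ha); push_cast at this ⊢; omega)

/-- **PADÉ ∕ LFSR UNIQUENESS IN FRACTION FORM: for monic `m`, `m′`, residues `a ∈ K[X]_{< deg m}`, `a′ ∈ K[X]_{< deg m′}` and `deg m + deg m′ ≤ N + 1`, the dual classes agree on `[0, N]`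
iff `a·m′ = a′·m`** (both are dual classes of the common modulus `m m′`, of degree `≤ N + 1`, with residues `a m′`, `a′ m` of degree `< deg m + deg m′`; N32's uniqueness). -/
theorem dualSeq_agree_iff_mul_eq {m m' a a' : K[X]} (hm : m.Monic) (hm' : m'.Monic) (ha : a ∈ Polynomial.degreeLT K m.natDegree) (ha' : a' ∈ Polynomial.degreeLT K m'.natDegree)
    (hN : m.natDegree + m'.natDegree ≤ N + 1) : (∀ j ≤ N, dualSeq K m a j = dualSeq K m' a' j) ↔ a * m' = a' * m := by
  have hmm : (m * m').Monic := hm.mul hm'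
  have hdeg : (m * m').natDegree = m.natDegree + m'.natDegree := Polynomial.natDegree_mul hm.ne_zero hm'.ne_zero
  constructor
  · intro h
    refine dualSeq_unique K (N := N) hmm (by rw [hdeg]; exact hN) (by rw [hdeg]; exact mul_mem_degreeLT_add K ha hm')
      (by rw [hdeg, add_comm]; exact mul_mem_degreeLT_add K ha' hm) fun j hj => ?_
    rw [← dualSeq_eq_dualSeq_prod_left K hm hm', ← dualSeq_eq_dualSeq_prod_right K hm hm']
    exact h j hj
  · intro h j _
    rw [dualSeq_eq_dualSeq_prod_left K hm hm', dualSeq_eq_dualSeq_prod_right K hm hm', h]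

/-- **… and then the two classes agree at EVERY index** (two LFSR sequences of lengths `d`, `d′` with the same `d + d′` initial terms coincide). -/
theorem dualSeq_eq_of_agree {m m' a a' : K[X]} (hm : m.Monic) (hm' : m'.Monic) (ha : a ∈ Polynomial.degreeLT K m.natDegree) (ha' : a' ∈ Polynomial.degreeLT K m'.natDegree)
    (hN : m.natDegree + m'.natDegree ≤ N + 1) (h : ∀ j ≤ N, dualSeq K m a j = dualSeq K m' a' j) : dualSeq K m a = dualSeq K m' a' := by
  have hmul := (dualSeq_agree_iff_mul_eq K hm hm' ha ha' hN).mp h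
  rw [dualSeq_eq_dualSeq_prod_left K hm hm', dualSeq_eq_dualSeq_prod_right K hm hm', hmul]

/-- **REDUCED SYMBOLS ARE DETERMINED: if moreover `gcd(m, a) = 1 = gcd(m′, a′)`, agreement on `[0, N]` (`deg m + deg m′ ≤ N + 1`) forces `m = m′` and `a = a′`.** -/
theorem eq_and_eq_of_agree_of_isCoprime {m m' a a' : K[X]} (hm : m.Monic) (hm' : m'.Monic) (ha : a ∈ Polynomial.degreeLT K m.natDegree) (ha' : a' ∈ Polynomial.degreeLT K m'.natDegree)
    (hma : IsCoprime m a) (hm'a' : IsCoprime m' a') (hN : m.natDegree + m'.natDegree ≤ N + 1) (h : ∀ j ≤ N, dualSeq K m a j = dualSeq K m' a' j) : m = m' ∧ a = a' := by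
  have hmul := (dualSeq_agree_iff_mul_eq K hm hm' ha ha' hN).mp h
  -- `m ∣ a′ m = a m′` and `gcd(m, a) = 1 ⇒ m ∣ m′`; symmetrically `m′ ∣ m`
  have h1 : m ∣ m' := hma.dvd_of_dvd_mul_left ⟨a', by rw [hmul, mul_comm]⟩
  have h2 : m' ∣ m := hm'a'.dvd_of_dvd_mul_left ⟨a, by rw [← hmul, mul_comm]⟩
  have hmm : m = m' := Polynomial.eq_of_monic_of_associated hm hm' (associated_of_dvd_dvd h1 h2)
  subst hmm
  exact ⟨rfl, mul_right_cancel₀ hm.ne_zero hmul⟩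

end Summit.Ventures.HSemireg.Wedge.HankelOuter
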